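import Mathlib.Tactic.Linarith
import Mathlib.Tactic.NormNum
import Mathlib.Tactic.Ring
import HarnessLib

/-!
# The (0,1) cell of the ι-window, XXXIII (companion E): the product ground `B₁ × B₂`, XX — THE CORNER IV, ADDENDUM 3: THEOREM UNIT-VOID (moving the
# Serre class with frozen trace on Y₁) for branch (I) of (Q-RES) (report [XXXIII] `H2-ZERO-ONE-33.md` §15): arithmetic shadows

Family `hodge`, b2b cell `hweil` (helper of item stmt-HodgeConjecture-2524). Report
`run/shared/lean/b2b/hodge-weil/b2b-hweil-pv1-g45/H2-ZERO-ONE-33.md` ([XXXIII]) §15 (ADDENDUM 3). Context: a branch-(I) partner `𝓠` is the Hartshorne–Serre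
extension along its degeneracy curve `W` with class a UNIT `e` of `H⁰(W, 𝓝_W)`, `𝓝_W ≅ 𝒪_W` invertible; rescaling `e` by ι-invariant units `f` of `H⁰(𝒪_W)` with
`f|_{W∩Y₁} = 1` produces pairwise non-isomorphic partners with the SAME restriction to `Y₁`, so PRINCIPLE Y² gives `e₁^ι(F) ≥ h⁰(𝒪_W)^+ − 2(W·S)` for every
corner sheaf on `𝓠`. The theorems below are the integer bookkeeping of the component-wise lower bounds: for a primitive structure of multiplicity `m` on a smooth
`Γ` of genus `g` with conormal `L`, `(m−1)·deg L = 2g − 2 + κ_Γ` forces `2·Σ_{i<m} χ(L^i) = 2(g−1) + mκ_Γ`; for an ι-fixed ribbon (`m = 2`, `φ ≤ 2g+2` fixed points)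
the free parameters are `≥ κ_Γ/2 − 4(Γ·θ₁) = ((2n₃ − n′ − 8)(Γ·θ₁) + (2d₃ − 6)(Γ·f′))/2`; for an ι-fixed primitive structure on a vertical fibre (no condition on
`Y₁`) they are `≥ (4 + (d₃ − 6)m)/2 ≥ 2 + 2m`. None of the theorems claims geometry. HONEST FRAMING: census work inside the ladder's H2 test ((0,1) cell) on the
SPECIAL fourfold `X₀`; nothing here is a rung; no case of the Hodge conjecture is proved; no statement of [Markman 2025] / [Perry 2026] / [EdGFS 2025] is used.
-/

-- mandated namespace `Summit.HodgeConjecture.HodgeConjecture.…` (Problem = Summit) trips `linter.dupNamespace`; the lakefile disables it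
-- tree-wide (weak option), restated here so stand-alone elaboration is warning-free too.
set_option linter.dupNamespace false

namespace Summit.HodgeConjecture.HodgeConjecture.WeilTypeLadder

section ProductGroundTwentyAddThree

/-- **[XXXIII] 15.3 (the Euler characteristics of the conormal powers of a primitive structure).** If `(m − 1)·D = 2g − 2 + κ` (the ω-condition for a primitive
structure of multiplicity `m` with conormal line bundle of degree `D` on a smooth curve of genus `g`), then `2·Σ_{i=1}^{m−1} (iD + 1 − g) = D·m(m−1) + 2(m−1)(1−g) =
2(g − 1) + mκ`; here the closed form of the sum is taken as given (`Σ_{i=1}^{m−1} i = m(m−1)/2`) and the identity checked. [`nlinarith`/`ring`-style linear combination] -/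
theorem pg20d_conormal_chi_sum :
    ∀ m D g κ : ℤ, (m - 1) * D = 2 * g - 2 + κ → D * (m * (m - 1)) + 2 * (m - 1) * (1 - g) = 2 * (g - 1) + m * κ := by
  intro m D g κ h
  have h' : D * (m * (m - 1)) = m * ((m - 1) * D) := by ring
  rw [h', h]
  ring

/-- **[XXXIII] 15.3 (b) (the ι-fixed ribbon bound).** With `κ_Γ = (2n₃ − n′)(Γ·θ₁) + (2d₃ − 6)(Γ·f′)` and `2(W₁·S) = 4(Γ·θ₁)` conditions on `Y₁`, the free parameters
of THEOREM UNIT-VOID on an ι-fixed ribbon component are `≥ 1 + (g − 1 + κ_Γ − φ/2)/2 − 4(Γ·θ₁) ≥ κ_Γ/2 − 4(Γ·θ₁)` (`φ ≤ 2g + 2`), and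
`2(κ_Γ/2 − 4(Γ·θ₁)) = (2n₃ − n′ − 8)(Γ·θ₁) + (2d₃ − 6)(Γ·f′)`. For `n₃ = n′ ≥ 10`, `d₃ ≥ 10`, `Γ·θ₁ = 2k ≥ 0`, `Γ·f′ ≥ 0`, `(Γ·θ₁, Γ·f′) ≠ (0,0)`: this is `≥ 4`, i.e.
the bound is `≥ 2` — VOID. For `n₃ = n′ − 1`, `n′ = 10` it is `(2d₃ − 6)(Γ·f′)`: `≥ 14` if `Γ·f′ ≥ 1`, but `0` for horizontal components. [`ring` / `omega`] -/
theorem pg20d_fixed_ribbon_bound :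
    (∀ n₃ n' d₃ t f : ℤ, 2 * (((2 * n₃ - n') * t + (2 * d₃ - 6) * f) - 8 * t) = 2 * ((2 * n₃ - n' - 8) * t + (2 * d₃ - 6) * f)) ∧
    (∀ n' d₃ k f : ℤ, 10 ≤ n' → 10 ≤ d₃ → 0 ≤ k → 0 ≤ f → (1 ≤ k ∨ 1 ≤ f) →
        4 ≤ (2 * n' - n' - 8) * (2 * k) + (2 * d₃ - 6) * f) ∧
    (∀ d₃ f : ℤ, 10 ≤ d₃ → (2 * (10 - 1) - 10 - 8) * 2 + (2 * d₃ - 6) * f = (2 * d₃ - 6) * f ∧ (1 ≤ f → 14 ≤ (2 * d₃ - 6) * f)) := by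
  refine ⟨fun n₃ n' d₃ t f => by ring, fun n' d₃ k f hn hd hk hf h => ?_, fun d₃ f hd => ⟨by ring, fun hf => by nlinarith⟩⟩
  rcases h with h1 | h1
  · nlinarith
  · nlinarith

/-- **[XXXIII] 15.3 (c) (ι-fixed primitive structures on vertical fibres: no condition on `Y₁`, many invariant functions).** For `{x₀} × C₂` (`g = 2`, `φ = 6`,
`Γ·θ₁ = 0`, `Γ·f′ = 1`, `κ = 2d₃ − 6`): `Σ_{i<m} χ(L^i) = 1 + (d₃ − 3)m` (from `2(g−1) + mκ = 2 + m(2d₃ − 6)`), and subtracting the Lefschetz defect `≤ 3` per term,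
`h⁰(𝒪_{W₁})^+ − 1 ≥ (1 + (d₃ − 3)m − 3(m − 1))/2 = (4 + (d₃ − 6)m)/2 ≥ 2 + 2m ≥ 6` for `d₃ ≥ 10`, `m ≥ 2`: VOID for every multiplicity. [`omega`/`nlinarith`] -/
theorem pg20d_vertical_rope_bound :
    (∀ d₃ m : ℤ, 2 + m * (2 * d₃ - 6) = 2 * (1 + (d₃ - 3) * m)) ∧
    (∀ d₃ m : ℤ, (1 + (d₃ - 3) * m) - 3 * (m - 1) = 4 + (d₃ - 6) * m) ∧
    (∀ d₃ m : ℤ, 10 ≤ d₃ → 2 ≤ m → 2 * (2 + 2 * m) ≤ 4 + (d₃ - 6) * m ∧ 6 ≤ 2 + 2 * m) := by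
  refine ⟨fun d₃ m => by ring, fun d₃ m => by ring, fun d₃ m hd hm => ⟨by nlinarith, by omega⟩⟩

/-- **[XXXIII] 15.3 (a) (free ι-orbits of primitive structures).** For a connected component `W₁` in a free ι-orbit, the free parameters are
`≥ χ(𝒪_{W₁}) − 2(W₁·S) = mκ_Γ/2 − 2m(Γ·θ₁)`, and `2(mκ_Γ/2 − 2m(Γ·θ₁)) = m((2n₃ − n′ − 4)(Γ·θ₁) + (2d₃ − 6)(Γ·f′))`; for `2n₃ − n′ ≥ 8` (both branch-(I) values of `n₃`
when `n′ ≥ 10`), `d₃ ≥ 10`, `m ≥ 2`, `(Γ·θ₁, Γ·f′) = (2k, f) ≠ (0,0)`: `≥ 16`, so the bound is `≥ 8`: VOID. [`ring` / `nlinarith`] -/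
theorem pg20d_free_orbit_bound :
    (∀ m n₃ n' d₃ t f : ℤ, 2 * ((m * ((2 * n₃ - n') * t + (2 * d₃ - 6) * f)) - 2 * 2 * m * t) = 2 * (m * ((2 * n₃ - n' - 4) * t + (2 * d₃ - 6) * f))) ∧
    (∀ m c d₃ k f : ℤ, 8 ≤ c → 10 ≤ d₃ → 2 ≤ m → 0 ≤ k → 0 ≤ f → (1 ≤ k ∨ 1 ≤ f) →
        16 ≤ m * ((c - 4) * (2 * k) + (2 * d₃ - 6) * f)) := by
  refine ⟨fun m n₃ n' d₃ t f => by ring, fun m c d₃ k f hc hd hm hk hf h => ?_⟩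
  have hin : 8 ≤ (c - 4) * (2 * k) + (2 * d₃ - 6) * f := by
    rcases h with h1 | h1
    · nlinarith
    · nlinarith
  nlinarith

end ProductGroundTwentyAddThree

end Summit.HodgeConjecture.HodgeConjecture.WeilTypeLadder
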